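import Summits.CriticalPhenomena.Ising3D.TaylorTableIdentityC
import Summits.CriticalPhenomena.Ising3D.TaylorTableIdentity
import Mathlib.Tactic.Linarith
import Mathlib.Tactic.Positivity
import Mathlib.Tactic.Ring
import HarnessLib

/-!
# Centred-form identity leaf check (T6 piece (iv)): `identityLeafC` + `identity_pos_of_kdCheckC`
(cell `pub-ising3x`, seat boot-1 gen 17; HOME/pub-ising3x-boot-1/b3spine-g17/IDENTITY-B3.md)

HONEST FRAMING: lottery ticket; floor = tightest certified 3D Ising CFT bounds; no exact-solution
claim without a proof. Island framing: certified exclusion region at stated derivative order and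
assumptions; not a determination of the 3D Ising critical exponents beyond that.

* `rangeMI S P lo hi` — a CENTRED-FORM range enclosure of an interval polynomial on `[lo, hi]`
  (Taylor shift to the midpoint with the tree's `PolyMP.shiftI`, constant coefficient ± the absolute
  tail bound `absBoundI`; the construction of `PolyMP.posCore` turned into an interval), `mem_rangeMI`.
* `identityLeafC c L S` — leaf check for a box `[σlo,σhi] × [εlo,εhi] × [klo,khi]`: with the EXACT
  Δ-polynomials `idQSumListQ` of `Î₁, Î₂, Î₄+Î₅` (TaylorTableIdentityC) it encloses
  `Î₁(x₀)`, `Î₂(x₁)`, `(Î₄+Î₅)((x₀+x₁)/2)` by `rangeMI` and `κ ∈ [klo, khi]` as an interval, and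
  decides `0 < lo(Î₁ ⊕ κ²Î₂ ⊕ κ(Î₄+Î₅))`; `identityLeafC_sound`.
* `identity_pos_of_kdCheckC` — the TABLE THEOREM for field (I) with this leaf check plugged into the
  generic `KdCert.sound` (BoxCover), same hypotheses/conclusion shape as `identity_pos_of_kdCheck`.
Elementary (Moore 1966 Ch. 3 centred forms; Neumaier 1990 §2.3). [folklore]
-/

namespace Summit.CriticalPhenomena.Ising3D

open Finset Set
open Literature.Analysis.ValidatedNumerics Literature.Analysis.ValidatedNumerics.PolyMP
open Literature.Analysis.ValidatedNumerics.NumericsMP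
open Literature.MathematicalPhysics.QuantumFieldTheory.ConformalBootstrap3D

/-! ### A centred-form range enclosure for interval polynomials -/

/-- **Centred-form range enclosure** of an interval polynomial on `[lo, hi]`: shift to the midpoint,
then `[s₀.lo − T, s₀.hi + T]` with `T` the scaled absolute bound of the tail on `|y| ≤ (hi−lo)/2`.
[folklore] -/
def rangeMI (S : ℕ) (P : IPoly) (lo hi : ℚ) : MI :=
  let mid : ℚ := (lo + hi) / 2
  let hw : ℚ := (hi - lo) / 2
  match shiftI S P (MI.ofFrac S mid.num mid.den) with
  | [] => ⟨0, 0⟩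
  | s0 :: tail =>
    ⟨s0.lo - Numerics.cdiv (hw.num * absBoundI S hw.num hw.den tail) hw.den,
     s0.hi + Numerics.cdiv (hw.num * absBoundI S hw.num hw.den tail) hw.den⟩

/-- **Soundness of `rangeMI`**: the value of any real polynomial in the interval polynomial at any
point of `[lo, hi]` lies in the enclosure. [folklore] -/
theorem mem_rangeMI {S : ℕ} (hS : 0 < S) {P : IPoly} {lo hi : ℚ} (hle : lo ≤ hi)
    {as : List ℝ} (has : PMem S as P) {x : ℝ} (hlo : (lo : ℝ) ≤ x) (hhi : x ≤ hi) :
    MI.mem S (evalR as x) (rangeMI S P lo hi) := by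
  set mid : ℚ := (lo + hi) / 2 with hmid
  set hw : ℚ := (hi - lo) / 2 with hhw
  have hmidR : ((mid : ℚ) : ℝ) = ((lo : ℝ) + hi) / 2 := by rw [hmid]; push_cast; ring
  have hhwR : ((hw : ℚ) : ℝ) = ((hi : ℝ) - lo) / 2 := by rw [hhw]; push_cast; ring
  have hc : MI.mem S ((mid : ℚ) : ℝ) (MI.ofFrac S mid.num mid.den) := by
    rw [ratCast_eq_num_div_den]; exact MI.mem_ofFrac S mid.num mid.pos
  have hsh := pmem_shiftI hS hc has
  unfold rangeMI
  simp only [← hmid, ← hhw]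
  generalize hsp : shiftI S P (MI.ofFrac S mid.num mid.den) = SP at hsh
  have hSr : (0 : ℝ) < S := by exact_mod_cast hS
  match SP, hsh with
  | [], hsh =>
    generalize hsr : shiftR as ((mid : ℚ) : ℝ) = SR at hsh
    match SR, hsh with
    | [], _ =>
      have hev : evalR as x = 0 := by
        have h1 : evalR as x = evalR (shiftR as ((mid : ℚ) : ℝ)) (x - mid) := by
          rw [evalR_shiftR]; congr 1; ring
        rw [h1, hsr, evalR_nil]
      simp only [hev, MI.mem, Int.cast_zero, zero_mul, le_refl, and_self]
  | s0 :: tail, hsh =>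
    generalize hsr : shiftR as ((mid : ℚ) : ℝ) = SR at hsh
    match SR, hsh with
    | a0 :: tR, List.Forall₂.cons ha0 htail =>
      have hev : evalR as x = evalR (a0 :: tR) (x - mid) := by
        rw [← hsr, evalR_shiftR]; congr 1; ring
      rw [hev, evalR_cons]
      have hy : |x - mid| ≤ ((hw : ℚ) : ℝ) := by
        rw [hmidR, hhwR, abs_le]; constructor <;> linarith
      have hwnn : 0 ≤ hw := by rw [hhw]; linarith
      have hn0 : 0 ≤ hw.num := Rat.num_nonneg.mpr hwnn
      have hB := absBoundR_le_absBoundI (S := S) hn0 hw.pos htail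
      rw [← ratCast_eq_num_div_den] at hB
      have htl := abs_evalR_le_absBoundR tR hy
      have hdz : (0 : ℤ) < hw.den := by exact_mod_cast hw.pos
      have hcd := Numerics.le_cdiv_mul_real (a := hw.num * absBoundI S hw.num hw.den tail) hdz
      have hwR : ((hw : ℚ) : ℝ) = (hw.num : ℝ) / hw.den := ratCast_eq_num_div_den hw
      have hdR : (0 : ℝ) < hw.den := by exact_mod_cast hw.pos
      have key : ((hw : ℚ) : ℝ) * absBoundR tR ((hw : ℚ) : ℝ) * S ≤
          ((Numerics.cdiv (hw.num * absBoundI S hw.num hw.den tail) hw.den : ℤ) : ℝ) := by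
        have h5 : ((hw.num * absBoundI S hw.num hw.den tail : ℤ) : ℝ) ≤
            ((Numerics.cdiv (hw.num * absBoundI S hw.num hw.den tail) hw.den : ℤ) : ℝ) * hw.den := by
          exact_mod_cast hcd
        push_cast at h5
        have hnr : (0 : ℝ) ≤ hw.num := by exact_mod_cast hn0
        have h4 : (hw.num : ℝ) * (absBoundR tR ((hw:ℚ):ℝ) * S) ≤ (hw.num : ℝ) * (absBoundI S hw.num hw.den tail : ℝ) :=
          mul_le_mul_of_nonneg_left hB hnr
        rw [hwR] at h4 ⊢
        rw [div_mul_eq_mul_div, div_mul_eq_mul_div, div_le_iff₀ hdR]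
        nlinarith [h4, h5]
      have hprod : |(x - mid) * evalR tR (x - mid)| ≤ ((hw : ℚ) : ℝ) * absBoundR tR ((hw : ℚ) : ℝ) := by
        rw [abs_mul]
        have hwnnR : (0 : ℝ) ≤ ((hw : ℚ) : ℝ) := by exact_mod_cast hwnn
        exact mul_le_mul hy htl (abs_nonneg _) hwnnR
      have h1 := (abs_le.1 hprod).1
      have h2 := (abs_le.1 hprod).2
      obtain ⟨ha0l, ha0h⟩ := ha0
      constructor
      · push_cast; nlinarith [h1, key, ha0l, hSr]
      · push_cast; nlinarith [h2, key, ha0h, hSr]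

/-! ### The leaf check -/

/-- Exact rational coefficient list ↦ interval polynomial at scale `S` (outward-rounded points). [folklore] -/
def ipolyOfQ (S : ℕ) (l : List ℚ) : IPoly := l.map (ofRat S)

/-- [folklore] -/
theorem pmem_ipolyOfQ (S : ℕ) : ∀ l : List ℚ, PMem S (l.map ((↑) : ℚ → ℝ)) (ipolyOfQ S l)
  | [] => pmem_nil S
  | q :: l => by
      rw [List.map_cons, ipolyOfQ, List.map_cons]
      exact pmem_cons (mem_ofRat S q) (pmem_ipolyOfQ S l)

/-- The interval hull `[⌊klo·S⌋, ⌈khi·S⌉]` of two rationals. [folklore] -/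
def hullMI (S : ℕ) (klo khi : ℚ) : MI := ⟨(ofRat S klo).lo, (ofRat S khi).hi⟩

/-- [folklore] -/
theorem mem_hullMI (S : ℕ) {klo khi : ℚ} {x : ℝ} (h1 : (klo : ℝ) ≤ x) (h2 : x ≤ khi) :
    MI.mem S x (hullMI S klo khi) := by
  have hl := (mem_ofRat S klo).1
  have hh := (mem_ofRat S khi).2
  have hS0 : (0 : ℝ) ≤ (S : ℝ) := by exact_mod_cast Nat.zero_le S
  refine ⟨hl.trans ?_, le_trans ?_ hh⟩
  · exact mul_le_mul_of_nonneg_right h1 hS0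
  · exact mul_le_mul_of_nonneg_right h2 hS0

/-- **The centred-form identity leaf check** on a box `[σlo,σhi] × [εlo,εhi] × [klo,khi]` (coordinates
`0, 1, 2` of the `Box`): encloses `Î₁(x₀)`, `Î₂(x₁)`, `(Î₄+Î₅)((x₀+x₁)/2)` by `rangeMI` on the exact
Δ-polynomials and `κ` by the hull of `[klo, khi]`, then decides `0 < lo (Î₁ + κ²Î₂ + κ(Î₄+Î₅))`
(scaled). The leaf datum is the working scale `S`. [folklore] -/
def identityLeafC (c : Fin 5 → ℕ × ℕ → ℚ) (L : List (ℕ × ℕ)) (B : Box) (S : ℕ) : Bool :=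
  let σlo := (B.ivl 0).1; let σhi := (B.ivl 0).2
  let εlo := (B.ivl 1).1; let εhi := (B.ivl 1).2
  let klo := (B.ivl 2).1; let khi := (B.ivl 2).2
  let A := rangeMI S (ipolyOfQ S (idQSumListQ (c 0) (-1) L)) σlo σhi
  let Bv := rangeMI S (ipolyOfQ S (idQSumListQ (c 1) (-1) L)) εlo εhi
  let Cv := rangeMI S (ipolyOfQ S (addQL (idQSumListQ (c 3) (-1) L) (idQSumListQ (c 4) 1 L)))
    ((σlo + εlo) / 2) ((σhi + εhi) / 2)
  let K := hullMI S klo khi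
  let tot := MI.add A (MI.add (MI.mul S (MI.sqr S K) Bv) (MI.mul S K Cv))
  decide (0 < S) && decide (σlo ≤ σhi) && decide (εlo ≤ εhi) && decide (klo ≤ khi) && decide (0 < tot.lo)

/-- The real quantity the leaf check bounds: `Î₁(x₀) + x₂² Î₂(x₁) + x₂ (Î₄+Î₅)((x₀+x₁)/2)`. [folklore] -/
noncomputable def identityValC (c : Fin 5 → ℕ × ℕ → ℚ) (L : List (ℕ × ℕ)) (x : ℕ → ℝ) : ℝ :=
  qSum (fun ab => (c 0 ab : ℝ)) L.toFinset (x 0) (-1) 0 0 +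
    (x 2) ^ 2 * qSum (fun ab => (c 1 ab : ℝ)) L.toFinset (x 1) (-1) 0 0 +
    x 2 * (qSum (fun ab => (c 3 ab : ℝ)) L.toFinset ((x 0 + x 1) / 2) (-1) 0 0 +
      qSum (fun ab => (c 4 ab : ℝ)) L.toFinset ((x 0 + x 1) / 2) 1 0 0)

/-- **Soundness of the leaf check.** [folklore] -/
theorem identityLeafC_sound (c : Fin 5 → ℕ × ℕ → ℚ) {L : List (ℕ × ℕ)} (hL : L.Nodup)
    (B : Box) (S : ℕ) (h : identityLeafC c L B S = true) (x : ℕ → ℝ) (hx : B.mem x) :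
    0 < identityValC c L x := by
  unfold identityLeafC at h
  simp only [Bool.and_eq_true, decide_eq_true_eq] at h
  obtain ⟨⟨⟨⟨hS, hσ⟩, hε⟩, hk⟩, htot⟩ := h
  have h0 := hx 0; have h1 := hx 1; have h2 := hx 2
  -- the three polynomial enclosures
  have eA := mem_rangeMI hS hσ (pmem_ipolyOfQ S (idQSumListQ (c 0) (-1) L)) h0.1 h0.2
  have eB := mem_rangeMI hS hε (pmem_ipolyOfQ S (idQSumListQ (c 1) (-1) L)) h1.1 h1.2
  have hm1 : (((B.ivl 0).1 + (B.ivl 1).1) / 2 : ℚ) ≤ ((B.ivl 0).2 + (B.ivl 1).2) / 2 := by linarith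
  have hs1 : ((((B.ivl 0).1 + (B.ivl 1).1) / 2 : ℚ) : ℝ) ≤ (x 0 + x 1) / 2 := by
    push_cast; linarith [h0.1, h1.1]
  have hs2 : (x 0 + x 1) / 2 ≤ ((((B.ivl 0).2 + (B.ivl 1).2) / 2 : ℚ) : ℝ) := by
    push_cast; linarith [h0.2, h1.2]
  have eC := mem_rangeMI hS hm1
    (pmem_ipolyOfQ S (addQL (idQSumListQ (c 3) (-1) L) (idQSumListQ (c 4) 1 L))) hs1 hs2
  have eK := mem_hullMI S h2.1 h2.2
  rw [evalR_idQSumListQ (c 0) (-1) hL] at eA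
  rw [evalR_idQSumListQ (c 1) (-1) hL] at eB
  rw [map_cast_addQL, evalR_addR, evalR_idQSumListQ (c 3) (-1) hL, evalR_idQSumListQ (c 4) 1 hL] at eC
  push_cast at eA eB eC
  have eTot := MI.mem_add eA (MI.mem_add (MI.mem_mul hS (MI.mem_sqr hS eK) eB) (MI.mem_mul hS eK eC))
  have hlo := eTot.1
  have hSr : (0 : ℝ) < S := by exact_mod_cast hS
  have htotR : (0 : ℝ) < _ := Int.cast_pos.mpr htot
  have key := lt_of_lt_of_le htotR hlo
  have hval : 0 < identityValC c L x * S := by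
    unfold identityValC
    nlinarith [key]
  have h0S : 0 * (S : ℝ) < identityValC c L x * S := by simpa using hval
  exact lt_of_mul_lt_mul_right h0S hSr.le


/-! ### The table theorem for field (I) with the centred-form leaf check -/

/-- **TABLE THEOREM, field (I), centred form.** Same hypotheses and conclusion as
`identity_pos_of_kdCheck`, with the kd-tree's leaves checked by `identityLeafC` (exact Δ-polynomials,
Taylor-shifted range enclosures) instead of the natural interval extension of `identityExpr` — for
slaved-Ψ functionals whose identity q-sums cancel 10³–10⁴ : 1 this certifies in O(1) leaves where the
natural extension needs O(10³). [cite: KosPolandSimmonsduffin2014, §3.2 eq. (3.15)] -/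
theorem identity_pos_of_kdCheckC (c : Fin 5 → ℕ × ℕ → ℚ) {L : List (ℕ × ℕ)} (hL : L.Nodup)
    {σlo σhi εlo εhi r₁ r₂ klo khi : ℚ} (hkhi : 0 < khi)
    (hr₁ : r₁ ≤ εlo - σhi) (hr₂ : εhi - σlo ≤ r₂)
    (h₁ : klo ^ r₂.den ≤ (1 / 2 : ℚ) ^ (r₂.num : ℤ)) (h₂ : (1 / 2 : ℚ) ^ (r₁.num : ℤ) ≤ khi ^ r₁.den)
    {t : KdCert ℕ}
    (ht : t.check (identityLeafC c L) [(σlo, σhi), (εlo, εhi), (klo, khi)] = true) :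
    ∀ p ∈ Icc (σlo : ℝ) σhi ×ˢ Icc (εlo : ℝ) εhi,
      0 < (taylorCrossing (1 / 2) (1 / 2) L.toFinset (fun i ab => (c i ab : ℝ))).identityTerm p.1 p.2 := by
  intro p hp
  obtain ⟨⟨hσ1, hσ2⟩, ⟨hε1, hε2⟩⟩ := hp
  have hr₁' : (r₁ : ℝ) ≤ (εlo : ℝ) - (σhi : ℝ) := by exact_mod_cast hr₁
  have hr₂' : (εhi : ℝ) - (σlo : ℝ) ≤ (r₂ : ℝ) := by exact_mod_cast hr₂
  have hκ := half_rpow_mem_of_checks hkhi h₁ h₂ (t := p.2 - p.1) (by linarith) (by linarith)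
  have hmem : Box.mem [(σlo, σhi), (εlo, εhi), (klo, khi)] (identityPoint p.1 p.2) := by
    intro i
    match i with
    | 0 => exact ⟨hσ1, hσ2⟩
    | 1 => exact ⟨hε1, hε2⟩
    | 2 => exact hκ
    | n + 3 => simp [Box.ivl, identityPoint]
  have hpos := KdCert.sound (P := fun x => 0 < identityValC c L x)
    (fun B a h x hx => identityLeafC_sound c hL B a h x hx) t _ ht _ hmem
  rw [identityTerm_taylorCrossing_half_pos_iff]
  simpa [identityValC, identityPoint] using hpos

end Summit.CriticalPhenomena.Ising3D
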